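import Mathlib
import Summits.NavierStokesRegularity.NavierStokesRegularity.Theorems.FilamentSkeletonRssKelvinGateHolderGain
import Summits.NavierStokesRegularity.NavierStokesRegularity.Theorems.FilamentSkeletonRssKelvinGateTools

/-!
# Route `FilamentSkeletonRss` · crux `TransverseReductionRJ` (stmt-NavierStokesRegularity-21221) — line `kelvin_gate`,
# stub S2′ `EventualKelvinGate`: THE FREE RESOLVENT WITH ITS HÖLDER GAIN (package)

Helper file (theorems only, `--supports stmt-NavierStokesRegularity-21221 --as helper`).  HONEST FRAMING: analysis
bookkeeping for a HYPOTHETICAL filament-type rotating-self-similar blow-up route; nothing here bears on Navier–Stokes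
regularity; no stub is proved here.

* `integral_rpow_mul_exp_neg_eq_Gamma` — the Hölder constant of `…KelvinGateHolderGain` is a Gamma value:
  `I_β = ∫₀^∞ s^{-(1+β)/2} e^{-s} ds = Γ((1−β)/2)`;
* `free_resolvent_holder` — **the free resolvent of `𝓛_(α,0)` maps the Y-scale into `X ∩ C^{2,β}` for every `β < 1`,
  uniformly in the rate `α`**: one absolute `C ≥ 0` with `YBound F R ⇒ XBound W (C R)`, `𝓛_(α,0) W = F`, and
  `‖D²W(y) − D²W(y′)‖ ≤ C Γ((1−β)/2) R ‖y − y′‖^β` for all `0 < β < 1` (`free_resolvent` of `…KelvinGateFreeResolvent` +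
  `norm_fderiv_fderiv_freeResolvent_sub_le` of `…KelvinGateHolderGain`).  This is the statement an `R-β`-typed S2′
  (Hölder classes `X^{2,β} / Y^{1,β}`, g6/g7 memos) would consume at `U⁰ = 0`.
-/

set_option linter.dupNamespace false

noncomputable section

namespace Summit.NavierStokesRegularity.NavierStokesRegularity.Theorems.KelvinGate

open Set Function Filter Topology MeasureTheory Real Metric
open Literature.Analysis.FluidPDE Literature.Analysis.UnboundedOperators
open scoped Topology ENNReal

/-- `∫₀^∞ s^{-(1+β)/2} e^{-s} ds = Γ((1−β)/2)` for `β < 1`. -/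
theorem integral_rpow_mul_exp_neg_eq_Gamma {β : ℝ} (hβ1 : β < 1) :
    ∫ s in Ioi (0:ℝ), s ^ (-((1 + β) / 2)) * exp (-s) = Real.Gamma ((1 - β) / 2) := by
  rw [Real.Gamma_eq_integral (by linarith : 0 < (1 - β) / 2)]
  refine setIntegral_congr_fun measurableSet_Ioi fun s _ => ?_
  rw [mul_comm]
  congr 2
  ring

/-- **The free resolvent with its Hölder gain.**  There is an absolute `C ≥ 0` such that for every rate `α` and every
`F` with `YBound F R`, the free resolvent `W = ∫₀^∞ W_s ds` satisfies `XBound W (C R)`, solves `𝓛_(α,0) W = F`, and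
`‖D²W(y) − D²W(y′)‖ ≤ C Γ((1−β)/2) R ‖y − y′‖^β` for all `0 < β < 1` and all `y, y′`. -/
theorem free_resolvent_holder :
    ∃ C : ℝ, 0 ≤ C ∧ ∀ (α : ℝ) (F : EuclideanSpace ℝ (Fin 3) → EuclideanSpace ℝ (Fin 3)) (R : ℝ), YBound F R →
      XBound (fun y => ∫ s in Ioi (0:ℝ), (Real.exp (-(s / 2)) • rotZL (-(α * s)))
          (heatExtension F (1 - Real.exp (-s)) ((Real.exp (-(s / 2)) • rotZL (α * s)) y))) (C * R) ∧
        (∀ y, lerayLin α (fun _ => 0) (fun y => ∫ s in Ioi (0:ℝ), (Real.exp (-(s / 2)) • rotZL (-(α * s)))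
          (heatExtension F (1 - Real.exp (-s)) ((Real.exp (-(s / 2)) • rotZL (α * s)) y))) y = F y) ∧
        ∀ β : ℝ, 0 < β → β < 1 → ∀ y y' : EuclideanSpace ℝ (Fin 3),
          ‖fderiv ℝ (fderiv ℝ (fun y => ∫ s in Ioi (0:ℝ), (Real.exp (-(s / 2)) • rotZL (-(α * s)))
                (heatExtension F (1 - Real.exp (-s)) ((Real.exp (-(s / 2)) • rotZL (α * s)) y)))) y -
            fderiv ℝ (fderiv ℝ (fun y => ∫ s in Ioi (0:ℝ), (Real.exp (-(s / 2)) • rotZL (-(α * s)))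
                (heatExtension F (1 - Real.exp (-s)) ((Real.exp (-(s / 2)) • rotZL (α * s)) y)))) y'‖ ≤
            C * Real.Gamma ((1 - β) / 2) * R * ‖y - y'‖ ^ β := by
  obtain ⟨C, hC, h⟩ := free_resolvent
  refine ⟨max C 16, le_trans hC (le_max_left _ _), fun α F R hY => ?_⟩
  obtain ⟨hX, hEq⟩ := h α F R hY
  obtain ⟨hF, h0, h1, -, -⟩ := hY.unpack
  have hR : 0 ≤ R := hY.nonneg
  refine ⟨hX.mono (mul_le_mul_of_nonneg_right (le_max_left _ _) hR), hEq, fun β hβ0 hβ1 y y' => ?_⟩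
  have hΓ : 0 < Real.Gamma ((1 - β) / 2) := Real.Gamma_pos_of_pos (by linarith)
  have hg := norm_fderiv_fderiv_freeResolvent_sub_le hF h0 h1 α hβ0 hβ1 y y'
  rw [integral_rpow_mul_exp_neg_eq_Gamma hβ1] at hg
  refine hg.trans ?_
  have h16 : (16 : ℝ) ≤ max C 16 := le_max_right _ _
  have : 16 * R * Real.Gamma ((1 - β) / 2) * ‖y - y'‖ ^ β ≤ max C 16 * Real.Gamma ((1 - β) / 2) * R * ‖y - y'‖ ^ β := by
    have hpos : 0 ≤ R * Real.Gamma ((1 - β) / 2) * ‖y - y'‖ ^ β := by positivity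
    nlinarith
  linarith

end Summit.NavierStokesRegularity.NavierStokesRegularity.Theorems.KelvinGate

end
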